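import Summits.HodgeConjecture.HodgeConjecture.Theorems.H413E2SWKernelRallisOfSiegelWeil
import Summits.HodgeConjecture.HodgeConjecture.Theorems.H413E2SWEisStructure
import Summits.HodgeConjecture.HodgeConjecture.Theorems.H413E2SWIdentityClose
import Literature.NumberTheory.Weil1965.ThetaIntegralOrbitFunctionalUnitary
import Literature.NumberTheory.Weil1965.ThetaIntegralHermNormSdForm
import HarnessLib

/-!
# H413 · E-2 · SW2 (iii) — THE LAST FILE: the Siegel–Weil identity in Weil's range for the CM doubled pair, `StubSW2iii` BY NAME (skeleton)

Crux `stmt-HodgeConjecture-24833`; child line `Cruxes/H413/Lines/F0_E2SiegelWeilWeilRange.lean`, stub `stub_SW2iii_siegelWeil : StubSW2iii`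
(`2 < N → ∃ κ > 0, ∀ Ψ, Summable (eisSection … Ψ) ∧ I□ Ψ = κ · eis … Ψ`), stated over the ★ carriers `Li1992.DoubledPair.*` EXACTLY as the `hSW`
binder of ★ `Theorems/H413E2SWKernelRallisOfSiegelWeil.kernelRallisIdentityCM_of_siegelWeil` (PORT-A, A-p17 (g14)), so that (PORT-A) — hence the E-2
parent head and the P4 socket S6 — consumes it with ZERO unfolding.  KERNEL MATHEMATICS ONLY (theorems; no definition, no `sorry`); row F0P4-plan (g4)
2026-08-31T04:20:21Z «LAST FILE skeleton» (F0P4-p06 (g3)); closer-modulo-letters in the SW4 recipe.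

`siegelWeil_weilRange_CM_of (hFIB) (hICLOSE) : ‹StubSW2iii by name›` is PROVED HERE, sorry-free, from TWO named hypotheses, each the
head of its producer VERBATIM (fully quantified over that producer's own binders); the junction `hNorm = q_{C₀}`,
`C₀ = reindex (𝕋_F ⊕ −d 𝕋_F⁻¹)`, is ★ A-p16 (g18) `UnitaryDoubling.hNorm_eq_sdForm_C0` and is consumed INSIDE:
* `hICLOSE` — the I-CLOSE OUTER ASSEMBLY `I□(Ψ) = κ₀ · Eis(Ψ)` from (hhN, hB, htemp, hfib, hE) [B-p03 (g23) (T1) v2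
  `E2SWIdentityClose.doubledThetaIntegral_eq_mul_of_fibre`, skeleton v2];
* `hFIB` — the FIBREWISE PROPORTIONALITY `∫ Θ dμ̂_b = κ₀ ∫ Θ dμ_b` on nonnegative compactly supported `Θ ∈ 𝒮_ℝ` (the output of the split-place chain
  (BRIDGE-v)(J-v)(CV-v)(BOUND-b): B-p03 (T2)–(T3) over p07 (g3) A4, B-p18, B-p04, A-p01, A-p08, F0P4-p08), quantified over the full `StubSW2iii` datum, a
  Tamagawa-normalised Haar measure `νE` on `X□(𝔸)` and the E-side `h` (with `hhN`, `hB`).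
Everything else is ★ and discharged INSIDE: the Haar measure `νE` with `νE(D) = 1` (★ `exists_haar_measure_piFundamentalDomain_eq_one`), `κ := ν([U(J_V)]) > 0`,
the SUMMABLE SECTION conjunct (★ `E2SWEisDecompositionCM.summable_eisSection_of_isTotallyReal` — condition (B) ★ `hB_C0`), temperedness (★ `htemp_C0`), the
(E-DEC) Fourier side `hE` (★ `E2SWEisFourierSide.eis_eq_geomFrame_zero_add_tsum_siegelCoeff`), all at `h := q_{C₀}`; the carriers `DoubledPair.eisSection ∕ eis ∕
doubledThetaIntegral ∕ vDiagLift` unfold by `δ` to the producers' spellings (`vDiagLift = doublingLift ∘ iotaV` by `rfl`, B-p10 cert 8bc2a63a).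
The day the two producers are ★: `theorem siegelWeil_weilRange_CM := siegelWeil_weilRange_CM_of T3.… T1.…` (one line, this file's ED. 2).

HC_CM is proved only modulo the 7 printed citations until rung 0 closes; nothing here is about Hodge classes.

References: A. Weil, *Sur la formule de Siegel dans la théorie des groupes classiques*, Acta Math. 113 (1965), n° 51–52 Théorème 5 pp. 75–77 [Weil1965];
J.-S. Li, *Non-vanishing theorems for the cohomology of certain arithmetic quotients*, J. reine angew. Math. 428 (1992), (24)–(25) p. 184 [Li1992].
-/

set_option autoImplicit false

noncomputable section

-- Mathlib's measure ∕ quotient APIs are stated across semireducible wrappers; the carriers `Li1992.DoubledPair.*` unfold by `δ`.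
set_option backward.isDefEq.respectTransparency false
set_option linter.dupNamespace false

namespace Summit.HodgeConjecture.HodgeConjecture.Cruxes.H413.E2SWSiegelWeilCM

open scoped Matrix ENNReal ComplexOrder
open _root_.MeasureTheory NumberField
open Literature.RepresentationTheory.HeisenbergGroup Literature.RepresentationTheory.HeisenbergGroup.SymplecticMatrix
open Literature.NumberTheory.Weil1964 Literature.NumberTheory.Weil1965 Literature.NumberTheory.Automorphic
open Literature.NumberTheory.Weil1965.UnitaryDoubling
open Literature.NumberTheory.GelbartRogawski1991 Literature.NumberTheory.GelbartRogawski1991.UnitaryDualPair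
open Literature.NumberTheory.Li1992 Literature.NumberTheory.Li1992.DoubledPair
open Summit.HodgeConjecture.HodgeConjecture.Cruxes.H413

/-- **THE SIEGEL–WEIL IDENTITY IN WEIL'S RANGE FOR THE CM DOUBLED PAIR `(U(J_V), U(J_W ⊕ᶠ −J_W))` — `StubSW2iii` BY NAME — FROM THE TWO OPEN HEADS**
(`hFIB` = fibrewise proportionality on nonnegative compactly supported tests; `hICLOSE` = the I-CLOSE outer assembly; `hNorm = q_{C₀}` ★ inside),
everything else discharged: Tamagawa Haar measure on `X□(𝔸)`, `κ := ν([U(J_V)]) > 0`, the summable-section conjunct (condition (B) for `q_{C₀}`,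
`F` totally real, `2 < N`), temperedness, the Fourier side of the unfolded Eisenstein series. [cite: Weil1965, Thm. 5 (p. 76)] [cite: Li1992, (24)–(25) p. 184] -/
theorem siegelWeil_weilRange_CM_of
    (hFIB :
      ∀ (F E : Type) [Field F] [NumberField F] [Field E] [NumberField E] [Algebra F E]
        (c : E ≃ₐ[F] E) (N : ℕ) {n : ℕ} (e : Fin N × Fin 1 ≃ Fin n)
        {TV : Matrix (Fin N) (Fin N) F} {TW : Matrix (Fin 1) (Fin 1) F}
        [Algebra.IsQuadraticExtension F E]
        [IsTotallyReal F] [IsTotallyComplex E] (τ : E →+* ℂ) (hτ : ((TV.map (algebraMap F E)).map τ).PosDef)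
        {δ : E} (hcδ : c δ = -δ) (hδ : δ ≠ 0) {d : F}
        (hd : δ * δ = algebraMap F E d) (hV : TV.IsSymm) (hW : TW.IsSymm) (hVd : IsUnit TV.det) (hWd : IsUnit TW.det)
        [LocallyCompactSpace (UnitaryGroup.adelic F E c N (TV.map (algebraMap F E)))]
        [LocallyCompactSpace (UnitaryGroup.adelic F E c 1 (TW.map (algebraMap F E)))]
        (s : UnitaryGroup.adelicPair F E c N 1 (TV.map (algebraMap F E)) (TW.map (algebraMap F E)) →*
          adelicMpCont F (Fin n) (adelicGram F e TV TW))
        (hs : (splittingDatum F E c N 1 e (TV.map (algebraMap F E)) (TW.map (algebraMap F E)) hcδ hδ hd hV hW hVd hWd rfl rfl).IsCompatible s)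
        [CompactSpace (UnitaryGroup.adelic F E c N (TV.map (algebraMap F E)) ⧸
          (UnitaryGroup.toAdelic F E c N (TV.map (algebraMap F E))).range)]
        [CompactSpace (UnitaryGroup.adelic F E c 1 (TW.map (algebraMap F E)) ⧸
          (UnitaryGroup.toAdelic F E c 1 (TW.map (algebraMap F E))).range)]
        [MeasurableSpace (UnitaryGroup.adelic F E c N (TV.map (algebraMap F E)) ⧸
          (UnitaryGroup.toAdelic F E c N (TV.map (algebraMap F E))).range)]
        [BorelSpace (UnitaryGroup.adelic F E c N (TV.map (algebraMap F E)) ⧸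
          (UnitaryGroup.toAdelic F E c N (TV.map (algebraMap F E))).range)]
        (ν : Measure (UnitaryGroup.adelic F E c N (TV.map (algebraMap F E)) ⧸
          (UnitaryGroup.toAdelic F E c N (TV.map (algebraMap F E))).range))
        [IsFiniteMeasure ν] [ν.IsOpenPosMeasure]
        [SMulInvariantMeasure (UnitaryGroup.adelic F E c N (TV.map (algebraMap F E)))
          (UnitaryGroup.adelic F E c N (TV.map (algebraMap F E)) ⧸ (UnitaryGroup.toAdelic F E c N (TV.map (algebraMap F E))).range) ν]
        [MeasurableSpace (AdeleRing (𝓞 F) F)] [BorelSpace (AdeleRing (𝓞 F) F)]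
        (νX : Measure (Fin n → AdeleRing (𝓞 F) F)) [νX.IsAddHaarMeasure]
        (hiso : ∀ (p : UnitaryGroup.adelic F E c N (TV.map (algebraMap F E)) × UnitaryGroup.adelic F E c 1 (TW.map (algebraMap F E)))
            (Φ : piSchwartzBruhat F (Fin n)),
          ∫⁻ x, ‖((pairRep F E c N 1 e (TV.map (algebraMap F E)) (TW.map (algebraMap F E)) s) p Φ :
              (Fin n → AdeleRing (𝓞 F) F) → ℂ) x‖ₑ ^ 2 ∂νX =
            ∫⁻ x, ‖(Φ : (Fin n → AdeleRing (𝓞 F) F) → ℂ) x‖ₑ ^ 2 ∂νX),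
        2 < N →
        ∀ [MeasurableSpace (adeleQuotient F)] [BorelSpace (adeleQuotient F)]
          (νE : Measure (Fin (n + n) → AdeleRing (𝓞 F) F)) [νE.IsAddHaarMeasure]
          (_hνE : νE (piFundamentalDomain F (Fin (n + n))) = 1)
          (h : (Fin (n + n) → AdeleRing (𝓞 F) F) → AdeleRing (𝓞 F) F) (hh : Continuous h)
          (_hhN : ∀ x, h x = hNorm F E c hcδ hδ N e TV hVd TW hWd x)
          (hB : ∀ Φ ∈ piSchwartzBruhat F (Fin (n + n)), Summable fun ξ : F => ‖adelicSiegelCoeff F (Fin (n + n)) νE h Φ ξ‖),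
      ∀ (b : F) (Θ : piSchwartzBruhatReal F (Fin (n + n))), 0 ≤ (Θ : (Fin (n + n) → AdeleRing (𝓞 F) F) → ℝ) →
            HasCompactSupport (Θ : (Fin (n + n) → AdeleRing (𝓞 F) F) → ℝ) →
            ∫ x, (Θ : (Fin (n + n) → AdeleRing (𝓞 F) F) → ℝ) x ∂(fibreMeasure F (Fin (n + n)) (thetaOrbitFunctionalReal F E c hcδ hδ hd N e TV hV hVd TW hW hWd ν)
                  (thetaOrbitFunctionalReal_nonneg F E c hcδ hδ hd N e TV hV hVd TW hW hWd ν) h b) =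
              (ν Set.univ).toReal * ∫ x, (Θ : (Fin (n + n) → AdeleRing (𝓞 F) F) → ℝ) x ∂(adelicSiegelFibreMeasure F (Fin (n + n)) νE h hh hB b))
    (hICLOSE :
      ∀ (F E : Type) [Field F] [NumberField F] [Field E] [NumberField E] [Algebra F E] [Algebra.IsQuadraticExtension F E]
        (c : E ≃ₐ[F] E) {δ : E} (hcδ : c δ = -δ) (hδ : δ ≠ 0) {d : F} (hd : δ * δ = algebraMap F E d)
        (N : ℕ) {n : ℕ} (e : Fin N × Fin 1 ≃ Fin n)
        (TV : Matrix (Fin N) (Fin N) F) (hV : TV.IsSymm) (hVd : IsUnit TV.det)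
        (TW : Matrix (Fin 1) (Fin 1) F) (hW : TW.IsSymm) (hWd : IsUnit TW.det)
        [LocallyCompactSpace (UnitaryGroup.adelic F E c N (TV.map (algebraMap F E)))]
        [CompactSpace (UnitaryGroup.adelic F E c N (TV.map (algebraMap F E)) ⧸ (UnitaryGroup.toAdelic F E c N (TV.map (algebraMap F E))).range)]
        [MeasurableSpace (UnitaryGroup.adelic F E c N (TV.map (algebraMap F E)) ⧸ (UnitaryGroup.toAdelic F E c N (TV.map (algebraMap F E))).range)]
        [BorelSpace (UnitaryGroup.adelic F E c N (TV.map (algebraMap F E)) ⧸ (UnitaryGroup.toAdelic F E c N (TV.map (algebraMap F E))).range)]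
        (ν : Measure (UnitaryGroup.adelic F E c N (TV.map (algebraMap F E)) ⧸ (UnitaryGroup.toAdelic F E c N (TV.map (algebraMap F E))).range))
        [IsFiniteMeasure ν]
        [MeasurableSpace (adeleQuotient F)] [BorelSpace (adeleQuotient F)]
        [MeasurableSpace (AdeleRing (𝓞 F) F)] [BorelSpace (AdeleRing (𝓞 F) F)]
        (νX : Measure (Fin (n + n) → AdeleRing (𝓞 F) F)) [νX.IsAddHaarMeasure]
        (h : (Fin (n + n) → AdeleRing (𝓞 F) F) → AdeleRing (𝓞 F) F) (hh : Continuous h)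
        (hhN : ∀ x, h x = hNorm F E c hcδ hδ N e TV hVd TW hWd x)
        (hB : ∀ Φ ∈ piSchwartzBruhat F (Fin (n + n)), Summable fun ξ : F => ‖adelicSiegelCoeff F (Fin (n + n)) νX h Φ ξ‖)
        (htemp : ∀ Ψr : piSchwartzBruhatReal F (Fin (n + n)),
          Integrable (Ψr : (Fin (n + n) → AdeleRing (𝓞 F) F) → ℝ) (adelicSiegelMeasure F (Fin (n + n)) νX h hh hB) ∧
            ∫ x, (Ψr : (Fin (n + n) → AdeleRing (𝓞 F) F) → ℝ) x ∂(adelicSiegelMeasure F (Fin (n + n)) νX h hh hB) = adelicSiegelFunctional F (Fin (n + n)) νX h hh hB Ψr)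
        (hfib : ∀ (b : F) (Θ : piSchwartzBruhatReal F (Fin (n + n))), 0 ≤ (Θ : (Fin (n + n) → AdeleRing (𝓞 F) F) → ℝ) →
          HasCompactSupport (Θ : (Fin (n + n) → AdeleRing (𝓞 F) F) → ℝ) →
          ∫ x, (Θ : (Fin (n + n) → AdeleRing (𝓞 F) F) → ℝ) x ∂(fibreMeasure F (Fin (n + n)) (thetaOrbitFunctionalReal F E c hcδ hδ hd N e TV hV hVd TW hW hWd ν)
                (thetaOrbitFunctionalReal_nonneg F E c hcδ hδ hd N e TV hV hVd TW hW hWd ν) h b) =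
            (ν Set.univ).toReal * ∫ x, (Θ : (Fin (n + n) → AdeleRing (𝓞 F) F) → ℝ) x ∂(adelicSiegelFibreMeasure F (Fin (n + n)) νX h hh hB b))
        (Eis : piSchwartzBruhat F (Fin (n + n)) → ℂ)
        (hE : ∀ Ψ : piSchwartzBruhat F (Fin (n + n)), Eis Ψ =
          ((geomFrame F (adelicGram F e TV TW) (isUnit_det_adelicGram F e hVd hWd) Ψ : piSchwartzBruhat F (Fin (n + n))) : (Fin (n + n) → AdeleRing (𝓞 F) F) → ℂ) 0 + ∑' ξ : F, adelicSiegelCoeff F (Fin (n + n)) νX h ((geomFrame F (adelicGram F e TV TW) (isUnit_det_adelicGram F e hVd hWd) Ψ : piSchwartzBruhat F (Fin (n + n))) : (Fin (n + n) → AdeleRing (𝓞 F) F) → ℂ) ξ)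
        (Ψ : piSchwartzBruhat F (Fin (n + n))),
        ∫ ξ, thetaDistLM F (Fin (n + n))
            (adelicMpCont.omega F (Fin (n + n)) (doubledGramFin F (adelicGram F e TV TW))
              (((doublingLift F (adelicGram F e TV TW) (isUnit_det_adelicGram F e hVd hWd)).comp
                (iotaV F E c hcδ hδ hd N e TV hV TW hW)) (Quotient.out ξ)⁻¹) Ψ) ∂ν =
          ((ν Set.univ).toReal : ℂ) * Eis Ψ) :
      ∀ (F E : Type) [Field F] [NumberField F] [Field E] [NumberField E] [Algebra F E]
        (c : E ≃ₐ[F] E) (N : ℕ) {n : ℕ} (e : Fin N × Fin 1 ≃ Fin n)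
        {TV : Matrix (Fin N) (Fin N) F} {TW : Matrix (Fin 1) (Fin 1) F}
        [Algebra.IsQuadraticExtension F E]
        [IsTotallyReal F] [IsTotallyComplex E] (τ : E →+* ℂ) (hτ : ((TV.map (algebraMap F E)).map τ).PosDef)
        {δ : E} (hcδ : c δ = -δ) (hδ : δ ≠ 0) {d : F}
        (hd : δ * δ = algebraMap F E d) (hV : TV.IsSymm) (hW : TW.IsSymm) (hVd : IsUnit TV.det) (hWd : IsUnit TW.det)
        [LocallyCompactSpace (UnitaryGroup.adelic F E c N (TV.map (algebraMap F E)))]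
        [LocallyCompactSpace (UnitaryGroup.adelic F E c 1 (TW.map (algebraMap F E)))]
        (s : UnitaryGroup.adelicPair F E c N 1 (TV.map (algebraMap F E)) (TW.map (algebraMap F E)) →*
          adelicMpCont F (Fin n) (adelicGram F e TV TW))
        (hs : (splittingDatum F E c N 1 e (TV.map (algebraMap F E)) (TW.map (algebraMap F E)) hcδ hδ hd hV hW hVd hWd rfl rfl).IsCompatible s)
        [CompactSpace (UnitaryGroup.adelic F E c N (TV.map (algebraMap F E)) ⧸
          (UnitaryGroup.toAdelic F E c N (TV.map (algebraMap F E))).range)]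
        [CompactSpace (UnitaryGroup.adelic F E c 1 (TW.map (algebraMap F E)) ⧸
          (UnitaryGroup.toAdelic F E c 1 (TW.map (algebraMap F E))).range)]
        [MeasurableSpace (UnitaryGroup.adelic F E c N (TV.map (algebraMap F E)) ⧸
          (UnitaryGroup.toAdelic F E c N (TV.map (algebraMap F E))).range)]
        [BorelSpace (UnitaryGroup.adelic F E c N (TV.map (algebraMap F E)) ⧸
          (UnitaryGroup.toAdelic F E c N (TV.map (algebraMap F E))).range)]
        (ν : Measure (UnitaryGroup.adelic F E c N (TV.map (algebraMap F E)) ⧸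
          (UnitaryGroup.toAdelic F E c N (TV.map (algebraMap F E))).range))
        [IsFiniteMeasure ν] [ν.IsOpenPosMeasure]
        [SMulInvariantMeasure (UnitaryGroup.adelic F E c N (TV.map (algebraMap F E)))
          (UnitaryGroup.adelic F E c N (TV.map (algebraMap F E)) ⧸ (UnitaryGroup.toAdelic F E c N (TV.map (algebraMap F E))).range) ν]
        [MeasurableSpace (AdeleRing (𝓞 F) F)] [BorelSpace (AdeleRing (𝓞 F) F)]
        (νX : Measure (Fin n → AdeleRing (𝓞 F) F)) [νX.IsAddHaarMeasure]
        (hiso : ∀ (p : UnitaryGroup.adelic F E c N (TV.map (algebraMap F E)) × UnitaryGroup.adelic F E c 1 (TW.map (algebraMap F E)))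
            (Φ : piSchwartzBruhat F (Fin n)),
          ∫⁻ x, ‖((pairRep F E c N 1 e (TV.map (algebraMap F E)) (TW.map (algebraMap F E)) s) p Φ :
              (Fin n → AdeleRing (𝓞 F) F) → ℂ) x‖ₑ ^ 2 ∂νX =
            ∫⁻ x, ‖(Φ : (Fin n → AdeleRing (𝓞 F) F) → ℂ) x‖ₑ ^ 2 ∂νX),
        2 < N →
          ∃ κ : ℝ, 0 < κ ∧ ∀ Ψ : piSchwartzBruhat F (Fin (n + n)),
            Summable (eisSection (actRat F N e TV hVd TW hWd) (ratDoubledW F E c hcδ hδ hd N e TV hV hVd TW hW hWd)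
                (stabDiagRat F N e TV hVd TW hWd) (ev0 F N e TV hVd TW hWd) Ψ) ∧
            doubledThetaIntegral F E c hcδ hδ hd N e TV hV hVd TW hW hWd ν Ψ =
              (κ : ℂ) * eis (actRat F N e TV hVd TW hWd) (ratDoubledW F E c hcδ hδ hd N e TV hV hVd TW hW hWd) (stabDiagRat F N e TV hVd TW hWd) (ev0 F N e TV hVd TW hWd) Ψ := by
  intro F E _ _ _ _ _ c N n e TV TW _ _ _ τ hτ δ hcδ hδ d hd hV hW hVd hWd _ _ s hs _ _ _ _ ν _ _ _ _ _ νX _ hiso hN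
  classical
  -- Borel structure on `𝔸_F ⧸ F` (the E-side functional's Fejér machinery) and the Tamagawa Haar measure on `X□(𝔸)`
  letI : MeasurableSpace (adeleQuotient F) := borel _
  haveI : BorelSpace (adeleQuotient F) := ⟨rfl⟩
  obtain ⟨νE, hνEH, hνE⟩ := exists_haar_measure_piFundamentalDomain_eq_one F (n := n + n)
  haveI := hνEH
  -- condition (B) for `q_{C₀}` (★ `hB_C0`)
  have hB := E2SWEisDecompositionCM.hB_C0 F E e hV hW hVd hWd hδ hd hN νE
  -- `κ := ν([U(J_V)]) > 0`
  have hκ : 0 < (ν Set.univ).toReal :=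
    ENNReal.toReal_pos (isOpen_univ.measure_pos ν Set.univ_nonempty).ne' (measure_ne_top ν _)
  refine ⟨(ν Set.univ).toReal, hκ, fun Ψ => ⟨?_, ?_⟩⟩
  · -- the SUMMABLE-SECTION conjunct (★ no-`hsum` (E-DEC) CM; carriers by `δ`)
    exact E2SWEisDecompositionCM.summable_eisSection_of_isTotallyReal F E c N e hcδ hδ hd hV hW hVd hWd s hs hN νE hνE Ψ
  · -- the IDENTITY: (T1) at `h := q_{C₀}`, fed with ★ `hNorm_eq_sdForm_C0`, ★ `hB_C0`, ★ `htemp_C0`, `hFIB` and the ★ Fourier side (no `hsum`)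
    exact hICLOSE F E c hcδ hδ hd N e TV hV hVd TW hW hWd ν νE
      (sdForm F (Literature.NumberTheory.Weil1964.ratMatrix F (Matrix.reindex finSumFinEquiv finSumFinEquiv (Matrix.fromBlocks (gram F e TV TW) 0 0 (-(d • (gram F e TV TW)⁻¹))))))
      (E2SWEisDecomposition.continuous_sdForm F _)
      (fun x => (hNorm_eq_sdForm_C0 F E c hcδ hδ hd N e TV hVd TW hWd x).symm) hB
      (E2SWEisDecompositionCM.htemp_C0 F E e hV hW hVd hWd hδ hd hN νE hB)
      (hFIB F E c N e τ hτ hcδ hδ hd hV hW hVd hWd s hs ν νX hiso hN νE hνE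
        (sdForm F (Literature.NumberTheory.Weil1964.ratMatrix F (Matrix.reindex finSumFinEquiv finSumFinEquiv (Matrix.fromBlocks (gram F e TV TW) 0 0 (-(d • (gram F e TV TW)⁻¹)))))) (E2SWEisDecomposition.continuous_sdForm F _)
        (fun x => (hNorm_eq_sdForm_C0 F E c hcδ hδ hd N e TV hVd TW hWd x).symm) hB)
      (eis (actRat F N e TV hVd TW hWd) (ratDoubledW F E c hcδ hδ hd N e TV hV hVd TW hW hWd) (stabDiagRat F N e TV hVd TW hWd) (ev0 F N e TV hVd TW hWd))
      (fun Ψ' => E2SWEisFourierSide.eis_eq_geomFrame_zero_add_tsum_siegelCoeff F E c N e hcδ hδ hd hV hW hVd hWd s hs hN νE hνE Ψ'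
        (E2SWEisDecompositionCM.summable_eisSection_of_isTotallyReal F E c N e hcδ hδ hd hV hW hVd hWd s hs hN νE hνE Ψ'))
      Ψ

/-! ## ED. 2 — the I-CLOSE outer assembly is ★ (`E2SWIdentityClose.doubledThetaIntegral_eq_mul_of_fibre`, B-p03 (g23) p811126): ONE binder left -/

/-- **`StubSW2iii` BY NAME FROM THE FIBREWISE PROPORTIONALITY ALONE**: `siegelWeil_weilRange_CM_of` with `hICLOSE` DISCHARGED by the ★ I-CLOSE outer
assembly `E2SWIdentityClose.doubledThetaIntegral_eq_mul_of_fibre` (B-p03 (g23)); the one remaining hypothesis `hFIB` is the split-place chain's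
`hfib_CM`. [cite: Weil1965, Thm. 5 (p. 76)] [cite: Li1992, (24)–(25) p. 184] -/
theorem siegelWeil_weilRange_CM_of_fib
    (hFIB :
      ∀ (F E : Type) [Field F] [NumberField F] [Field E] [NumberField E] [Algebra F E]
        (c : E ≃ₐ[F] E) (N : ℕ) {n : ℕ} (e : Fin N × Fin 1 ≃ Fin n)
        {TV : Matrix (Fin N) (Fin N) F} {TW : Matrix (Fin 1) (Fin 1) F}
        [Algebra.IsQuadraticExtension F E]
        [IsTotallyReal F] [IsTotallyComplex E] (τ : E →+* ℂ) (hτ : ((TV.map (algebraMap F E)).map τ).PosDef)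
        {δ : E} (hcδ : c δ = -δ) (hδ : δ ≠ 0) {d : F}
        (hd : δ * δ = algebraMap F E d) (hV : TV.IsSymm) (hW : TW.IsSymm) (hVd : IsUnit TV.det) (hWd : IsUnit TW.det)
        [LocallyCompactSpace (UnitaryGroup.adelic F E c N (TV.map (algebraMap F E)))]
        [LocallyCompactSpace (UnitaryGroup.adelic F E c 1 (TW.map (algebraMap F E)))]
        (s : UnitaryGroup.adelicPair F E c N 1 (TV.map (algebraMap F E)) (TW.map (algebraMap F E)) →*
          adelicMpCont F (Fin n) (adelicGram F e TV TW))
        (hs : (splittingDatum F E c N 1 e (TV.map (algebraMap F E)) (TW.map (algebraMap F E)) hcδ hδ hd hV hW hVd hWd rfl rfl).IsCompatible s)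
        [CompactSpace (UnitaryGroup.adelic F E c N (TV.map (algebraMap F E)) ⧸
          (UnitaryGroup.toAdelic F E c N (TV.map (algebraMap F E))).range)]
        [CompactSpace (UnitaryGroup.adelic F E c 1 (TW.map (algebraMap F E)) ⧸
          (UnitaryGroup.toAdelic F E c 1 (TW.map (algebraMap F E))).range)]
        [MeasurableSpace (UnitaryGroup.adelic F E c N (TV.map (algebraMap F E)) ⧸
          (UnitaryGroup.toAdelic F E c N (TV.map (algebraMap F E))).range)]
        [BorelSpace (UnitaryGroup.adelic F E c N (TV.map (algebraMap F E)) ⧸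
          (UnitaryGroup.toAdelic F E c N (TV.map (algebraMap F E))).range)]
        (ν : Measure (UnitaryGroup.adelic F E c N (TV.map (algebraMap F E)) ⧸
          (UnitaryGroup.toAdelic F E c N (TV.map (algebraMap F E))).range))
        [IsFiniteMeasure ν] [ν.IsOpenPosMeasure]
        [SMulInvariantMeasure (UnitaryGroup.adelic F E c N (TV.map (algebraMap F E)))
          (UnitaryGroup.adelic F E c N (TV.map (algebraMap F E)) ⧸ (UnitaryGroup.toAdelic F E c N (TV.map (algebraMap F E))).range) ν]
        [MeasurableSpace (AdeleRing (𝓞 F) F)] [BorelSpace (AdeleRing (𝓞 F) F)]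
        (νX : Measure (Fin n → AdeleRing (𝓞 F) F)) [νX.IsAddHaarMeasure]
        (hiso : ∀ (p : UnitaryGroup.adelic F E c N (TV.map (algebraMap F E)) × UnitaryGroup.adelic F E c 1 (TW.map (algebraMap F E)))
            (Φ : piSchwartzBruhat F (Fin n)),
          ∫⁻ x, ‖((pairRep F E c N 1 e (TV.map (algebraMap F E)) (TW.map (algebraMap F E)) s) p Φ :
              (Fin n → AdeleRing (𝓞 F) F) → ℂ) x‖ₑ ^ 2 ∂νX =
            ∫⁻ x, ‖(Φ : (Fin n → AdeleRing (𝓞 F) F) → ℂ) x‖ₑ ^ 2 ∂νX),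
        2 < N →
        ∀ [MeasurableSpace (adeleQuotient F)] [BorelSpace (adeleQuotient F)]
          (νE : Measure (Fin (n + n) → AdeleRing (𝓞 F) F)) [νE.IsAddHaarMeasure]
          (_hνE : νE (piFundamentalDomain F (Fin (n + n))) = 1)
          (h : (Fin (n + n) → AdeleRing (𝓞 F) F) → AdeleRing (𝓞 F) F) (hh : Continuous h)
          (_hhN : ∀ x, h x = hNorm F E c hcδ hδ N e TV hVd TW hWd x)
          (hB : ∀ Φ ∈ piSchwartzBruhat F (Fin (n + n)), Summable fun ξ : F => ‖adelicSiegelCoeff F (Fin (n + n)) νE h Φ ξ‖),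
      ∀ (b : F) (Θ : piSchwartzBruhatReal F (Fin (n + n))), 0 ≤ (Θ : (Fin (n + n) → AdeleRing (𝓞 F) F) → ℝ) →
            HasCompactSupport (Θ : (Fin (n + n) → AdeleRing (𝓞 F) F) → ℝ) →
            ∫ x, (Θ : (Fin (n + n) → AdeleRing (𝓞 F) F) → ℝ) x ∂(fibreMeasure F (Fin (n + n)) (thetaOrbitFunctionalReal F E c hcδ hδ hd N e TV hV hVd TW hW hWd ν)
                  (thetaOrbitFunctionalReal_nonneg F E c hcδ hδ hd N e TV hV hVd TW hW hWd ν) h b) =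
              (ν Set.univ).toReal * ∫ x, (Θ : (Fin (n + n) → AdeleRing (𝓞 F) F) → ℝ) x ∂(adelicSiegelFibreMeasure F (Fin (n + n)) νE h hh hB b)) :
      ∀ (F E : Type) [Field F] [NumberField F] [Field E] [NumberField E] [Algebra F E]
        (c : E ≃ₐ[F] E) (N : ℕ) {n : ℕ} (e : Fin N × Fin 1 ≃ Fin n)
        {TV : Matrix (Fin N) (Fin N) F} {TW : Matrix (Fin 1) (Fin 1) F}
        [Algebra.IsQuadraticExtension F E]
        [IsTotallyReal F] [IsTotallyComplex E] (τ : E →+* ℂ) (hτ : ((TV.map (algebraMap F E)).map τ).PosDef)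
        {δ : E} (hcδ : c δ = -δ) (hδ : δ ≠ 0) {d : F}
        (hd : δ * δ = algebraMap F E d) (hV : TV.IsSymm) (hW : TW.IsSymm) (hVd : IsUnit TV.det) (hWd : IsUnit TW.det)
        [LocallyCompactSpace (UnitaryGroup.adelic F E c N (TV.map (algebraMap F E)))]
        [LocallyCompactSpace (UnitaryGroup.adelic F E c 1 (TW.map (algebraMap F E)))]
        (s : UnitaryGroup.adelicPair F E c N 1 (TV.map (algebraMap F E)) (TW.map (algebraMap F E)) →*
          adelicMpCont F (Fin n) (adelicGram F e TV TW))
        (hs : (splittingDatum F E c N 1 e (TV.map (algebraMap F E)) (TW.map (algebraMap F E)) hcδ hδ hd hV hW hVd hWd rfl rfl).IsCompatible s)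
        [CompactSpace (UnitaryGroup.adelic F E c N (TV.map (algebraMap F E)) ⧸
          (UnitaryGroup.toAdelic F E c N (TV.map (algebraMap F E))).range)]
        [CompactSpace (UnitaryGroup.adelic F E c 1 (TW.map (algebraMap F E)) ⧸
          (UnitaryGroup.toAdelic F E c 1 (TW.map (algebraMap F E))).range)]
        [MeasurableSpace (UnitaryGroup.adelic F E c N (TV.map (algebraMap F E)) ⧸
          (UnitaryGroup.toAdelic F E c N (TV.map (algebraMap F E))).range)]
        [BorelSpace (UnitaryGroup.adelic F E c N (TV.map (algebraMap F E)) ⧸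
          (UnitaryGroup.toAdelic F E c N (TV.map (algebraMap F E))).range)]
        (ν : Measure (UnitaryGroup.adelic F E c N (TV.map (algebraMap F E)) ⧸
          (UnitaryGroup.toAdelic F E c N (TV.map (algebraMap F E))).range))
        [IsFiniteMeasure ν] [ν.IsOpenPosMeasure]
        [SMulInvariantMeasure (UnitaryGroup.adelic F E c N (TV.map (algebraMap F E)))
          (UnitaryGroup.adelic F E c N (TV.map (algebraMap F E)) ⧸ (UnitaryGroup.toAdelic F E c N (TV.map (algebraMap F E))).range) ν]
        [MeasurableSpace (AdeleRing (𝓞 F) F)] [BorelSpace (AdeleRing (𝓞 F) F)]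
        (νX : Measure (Fin n → AdeleRing (𝓞 F) F)) [νX.IsAddHaarMeasure]
        (hiso : ∀ (p : UnitaryGroup.adelic F E c N (TV.map (algebraMap F E)) × UnitaryGroup.adelic F E c 1 (TW.map (algebraMap F E)))
            (Φ : piSchwartzBruhat F (Fin n)),
          ∫⁻ x, ‖((pairRep F E c N 1 e (TV.map (algebraMap F E)) (TW.map (algebraMap F E)) s) p Φ :
              (Fin n → AdeleRing (𝓞 F) F) → ℂ) x‖ₑ ^ 2 ∂νX =
            ∫⁻ x, ‖(Φ : (Fin n → AdeleRing (𝓞 F) F) → ℂ) x‖ₑ ^ 2 ∂νX),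
        2 < N →
          ∃ κ : ℝ, 0 < κ ∧ ∀ Ψ : piSchwartzBruhat F (Fin (n + n)),
            Summable (eisSection (actRat F N e TV hVd TW hWd) (ratDoubledW F E c hcδ hδ hd N e TV hV hVd TW hW hWd)
                (stabDiagRat F N e TV hVd TW hWd) (ev0 F N e TV hVd TW hWd) Ψ) ∧
            doubledThetaIntegral F E c hcδ hδ hd N e TV hV hVd TW hW hWd ν Ψ =
              (κ : ℂ) * eis (actRat F N e TV hVd TW hWd) (ratDoubledW F E c hcδ hδ hd N e TV hV hVd TW hW hWd) (stabDiagRat F N e TV hVd TW hWd) (ev0 F N e TV hVd TW hWd) Ψ :=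
  siegelWeil_weilRange_CM_of hFIB E2SWIdentityClose.doubledThetaIntegral_eq_mul_of_fibre

end Summit.HodgeConjecture.HodgeConjecture.Cruxes.H413.E2SWSiegelWeilCM

end
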